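import Literature.AlgebraicGeometry.Motives.AbelianVarietyQuasiSectionPerfectField
import Literature.AlgebraicGeometry.Motives.AbelianVarietyQuasiDecompositionPartialSums
import Literature.AlgebraicGeometry.Motives.AbelianVarietyImageRestrict
import HarnessLib

/-!
# An `R`-simple abelian variety is isotypic

Let an abelian variety `X` over a field `K` carry an action `φ : R →+* End X` of a semiring `R`
and be **`R`-simple** (no abelian variety `W` with `R`-action and equivariant closed immersion
`W ↪ X` of dimension `0 < dim W < dim X`; the predicate is written out, binders explicit — the
setting of `Motives/AbelianVarietyEquivariantQuasiDecomposition`, `…EquivariantSchur`).  Then `X`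
is **isotypic**: all simple pieces of positive dimension of a decomposition of `X` up to isogeny
are isogenous to one another, i.e. `X ∼ Bⁿ` for ONE simple `B`.  Reason (Milne 1986 §12 p. 122 /
Shimura 1998 §5.1 proof of Prop. 3, with operators): the partial sum `E = ∑_{Sᵢ ∼ S_a} πᵢ ιᵢ` of a
decomposition `X ~ ⊕ Sᵢ` over an isogeny class is CENTRAL in `End X`
(`quasiDecomposition_partialSum_comm`, `Motives/AbelianVarietyQuasiDecompositionPartialSums`), so
its image `im E ↪ X` is stable under ANY action (`imageAction`,
`Motives/AbelianVarietyImageRestrict`); if a second isogeny class occurred, `im E` would be an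
`R`-stable abelian subvariety with `0 < dim (im E) < dim X`.

* `AbelianVariety.isIsogenous_of_simpleFor_of_quasiDecomposition` — any field, granted `hsimple`
  (non-zero homomorphisms between simple abelian varieties are isogenies; a theorem over perfect
  fields, `hsimple_of_perfectField`): the positive-dimensional simple pieces of a decomposition up
  to isogeny of an `R`-simple `X` are pairwise isogenous;
* `AbelianVariety.exists_isIsogenous_biproduct_power_of_simpleFor` — **over a perfect field, an
  `R`-simple abelian variety is isogenous to a power `⨁_{Fin n} B` of a simple abelian variety
  `B`** (the isogeny in the tree's direction `X ⟶ ⨁ B`).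

In particular (trivial action) a simple abelian variety is isotypic, and (an order of a CM field
acting) an abelian variety which is simple in the isogeny category WITH complex multiplication is
a power of a simple abelian variety up to isogeny — the first step of the structure theory of CM
abelian varieties (Shimura 1998 §5.1 Prop. 3; Milne 1986 §12).  Everything is proved; no
definition, no named fact (D-0026).

## References

* J. S. Milne, *Abelian Varieties*, in Cornell–Silverman (eds.), *Arithmetic Geometry* (1986), §12
  p. 122 (held copy `book:cornellnd-arithmetic-geometry`, PDF p. 189). [Milne1986AbelianVarieties]
* G. Shimura, *Abelian Varieties with Complex Multiplication and Modular Functions* (1998), §5.1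
  Prop. 3 and its proof (the central idempotents `εᵢ` of `End_ℚ(A)`). [Shimura1998]
* D. Mumford, *Abelian Varieties* (1970), §19 Thm. 1, Cor. 1–2 (pp. 173–174). [MumfordAV1970]
-/

noncomputable section

universe u v

open CategoryTheory CategoryTheory.Limits AlgebraicGeometry

namespace Literature.AlgebraicGeometry.Motives

namespace AbelianVariety

variable {K : Type u} [Field K] {R : Type v} [Semiring R]

section AnyField

variable {X : AbelianVariety K} {I : Type} [Fintype I] {S : I → AbelianVariety K}
  (ι : ∀ i, S i ⟶ X) (π : ∀ i, X ⟶ S i) {N : ℕ}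

/-- **The simple pieces of an `R`-simple abelian variety are pairwise isogenous.** Let `X` carry
an action `φ : R →+* End X` and be `R`-simple, and let `X ~ ⊕ Sᵢ` be a decomposition up to
isogeny into SIMPLE pieces (data `ι, π, N`: `ιᵢ πᵢ = N`, `ιᵢ πⱼ = 0 (i ≠ j)`, `∑ πᵢ ιᵢ = N`),
granted `hsimple` (non-zero homomorphisms between simple abelian varieties are isogenies — Mumford
§19 Cor. 2; over a perfect field `hsimple_of_perfectField`).  Then any two pieces `S_a`, `S_b` of
positive dimension are isogenous: otherwise the central partial sum `E = ∑_{Sᵢ ∼ S_a} πᵢ ιᵢ`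
(`quasiDecomposition_partialSum_comm`) has an `R`-stable image `im E ↪ X` (`imageAction`) with
`0 < dim (im E) < dim X` (`E ≠ 0` as `(π_a ι_a) E = N π_a ι_a ≠ 0`; `E` is not surjective as
`E (π_b ι_b) = 0 ≠ π_b ι_b`). [cite: Shimura1998, §5.1 Proposition 3 (proof)]
[cite: Milne1986AbelianVarieties, §12 p. 122 (PDF p. 189)] -/
theorem isIsogenous_of_simpleFor_of_quasiDecomposition
    (hsimple : ∀ (X Y : AbelianVariety K), IsSimple X → IsSimple Y →
      ∀ f : X ⟶ Y, f ≠ 0 → IsIsogeny f)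
    (φ : R →+* End X)
    (hX : ∀ (W : AbelianVariety K) (ω : R →+* End W) (w : W ⟶ X),
      IsClosedImmersion (Hom.toSchemeHom w) →
      (∀ r : R, w ≫ End.asHom (φ r) = End.asHom (ω r) ≫ w) → 0 < W.dim → W.dim < X.dim → False)
    (hS : ∀ i, IsSimple (S i)) (hN : 0 < N) (h1 : ∀ i, ι i ≫ π i = N • 𝟙 (S i))
    (h2 : ∀ i j, i ≠ j → ι i ≫ π j = 0) (h3 : ∑ i, π i ≫ ι i = N • 𝟙 X)
    {a b : I} (ha : 0 < (S a).dim) (hb : 0 < (S b).dim) : IsIsogenous (S a) (S b) := by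
  classical
  by_contra hab
  let P : I → Prop := fun i ↦ IsIsogenous (S i) (S a)
  set E : X ⟶ X := ∑ i ∈ Finset.univ.filter P, π i ≫ ι i with hE
  -- the isogeny class of `S a` is `Hom`-closed
  have hP : ∀ i j, P i → ¬ P j → (∀ f : S i ⟶ S j, f = 0) ∧ ∀ f : S j ⟶ S i, f = 0 := by
    intro i j hi hj
    refine ⟨?_, ?_⟩
    · rcases isIsogenous_or_forall_eq_zero (fun f hf ↦ hsimple _ _ (hS i) (hS j) f hf) with h | h
      · exact (hj (h.symm'.trans hi)).elim
      · exact h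
    · rcases isIsogenous_or_forall_eq_zero (fun f hf ↦ hsimple _ _ (hS j) (hS i) f hf) with h | h
      · exact (hj (h.trans hi)).elim
      · exact h
  have hcomm : ∀ G : X ⟶ X, E ≫ G = G ≫ E := fun G ↦
    quasiDecomposition_partialSum_comm ι π P hN h3 hP G
  -- `E ≠ 0`
  have hE0 : E ≠ 0 := by
    intro h0
    have e := quasiDecomposition_proj_comp_partialSum ι π P h1 h2 a
    rw [if_pos (show P a from IsIsogenous.refl (S a)), ← hE, h0, comp_zero] at e
    exact quasiDecomposition_proj_ne_zero ι π hN h1 ha (hom_eq_zero_of_nsmul_eq_zero hN.ne' e.symm)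
  -- `E` is not surjective
  have hEs : ¬ Function.Surjective (Hom.toSchemeHom E) := by
    intro hs
    haveI : Surjective (Hom.toSchemeHom E) := ⟨hs⟩
    haveI := epi_of_surjective_toSchemeHom E
    have hb' : ¬ P b := fun h ↦ hab h.symm'
    have e2 := quasiDecomposition_proj_comp_partialSum ι π P h1 h2 b
    rw [if_neg hb', ← hE, ← hcomm] at e2
    exact quasiDecomposition_proj_ne_zero ι π hN h1 hb ((cancel_epi E).1 (e2.trans comp_zero.symm))
  -- the image of `E`: an `R`-stable abelian subvariety with `0 < dim < dim X`
  have hι : ¬ Function.Surjective (Hom.toSchemeHom (imageι E)) := fun h ↦ hEs (by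
    rw [← toImage_imageι E]
    change Function.Surjective ((Hom.toSchemeHom (toImage E)) ≫ Hom.toSchemeHom (imageι E))
    rw [Scheme.Hom.comp_base]
    exact h.comp (surjective_toSchemeHom_toImage E).1)
  have hv : ∀ r : R, End.asHom (φ r) ≫ E = E ≫ End.asHom (φ r) := fun r ↦ (hcomm _).symm
  exact hX (image E) (imageAction E φ φ hv) (imageι E) (isClosedImmersion_toSchemeHom_imageι E)
    (fun r ↦ (imageAction_ι E φ φ hv r).symm) (dim_image_pos E hE0)
    (dim_lt_of_isClosedImmersion_of_not_surjective (imageι E) hι)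

end AnyField

/-- **An `R`-simple abelian variety over a perfect field is isotypic**: if `X` (over a perfect
field, with an action `φ : R →+* End X` of a semiring `R`) has no `R`-stable abelian subvariety of
dimension strictly between `0` and `dim X`, then `X` is isogenous to a power `⨁_{Fin n} B` of a
SIMPLE abelian variety `B` (Milne 1986 §12 p. 122 «`A` is isogenous to `∏ A_i^{r_i}`» with a single
isogeny class, by `isIsogenous_of_simpleFor_of_quasiDecomposition` applied to a decomposition of
`X` into simple pieces, `exists_quasiDecomposition_of_perfectField`). With the trivial action:
a simple abelian variety; with an order of a CM field acting: the isogeny factors of a CM-simple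
abelian variety are all isogenous. [cite: Milne1986AbelianVarieties, §12 p. 122 (PDF p. 189)]
[cite: Shimura1998, §5.1 Proposition 3] -/
theorem exists_isIsogenous_biproduct_power_of_simpleFor [PerfectField K] {X : AbelianVariety K}
    (φ : R →+* End X)
    (hX : ∀ (W : AbelianVariety K) (ω : R →+* End W) (w : W ⟶ X),
      IsClosedImmersion (Hom.toSchemeHom w) →
      (∀ r : R, w ≫ End.asHom (φ r) = End.asHom (ω r) ≫ w) → 0 < W.dim → W.dim < X.dim → False) :
    ∃ (B : AbelianVariety K) (n : ℕ), IsSimple B ∧ IsIsogenous X (⨁ fun _ : Fin n ↦ B) := by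
  classical
  obtain ⟨I, _, S, ι, π, N, hS, hN, h1, h2, h3⟩ := exists_quasiDecomposition_of_perfectField X
  obtain ⟨h1', h2', h3'⟩ := quasiDecomposition_prune ι π h1 h2 h3
  let I' := {i : I // 0 < (S i).dim}
  -- one simple `B` to which every positive-dimensional piece is isogenous
  obtain ⟨B, hB, hBiso⟩ : ∃ B : AbelianVariety K, IsSimple B ∧ ∀ i : I', IsIsogenous (S i.1) B := by
    by_cases hne : Nonempty I'
    · obtain ⟨a⟩ := hne
      exact ⟨S a.1, hS _, fun i ↦ isIsogenous_of_simpleFor_of_quasiDecomposition ι π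
        (hsimple_of_perfectField (K := K)) φ hX hS hN h1 h2 h3 i.2 a.2⟩
    · refine ⟨X, isSimple_of_dim_le_one ?_, fun i ↦ (hne ⟨i⟩).elim⟩
      -- no positive-dimensional piece: `N • 𝟙 X = 0`, so `dim X = 0`
      haveI : IsEmpty I' := not_nonempty_iff.1 hne
      have h0 : N • 𝟙 X = 0 := by rw [← h3', Finset.univ_eq_empty, Finset.sum_empty]
      have hX0 : ¬ 0 < X.dim := fun hX0 ↦
        id_ne_zero_of_dim_pos hX0 (hom_eq_zero_of_nsmul_eq_zero hN.ne' h0)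
      omega
  choose f hf using hBiso
  -- the tautological decomposition of `⨁_{I'} B` and the re-assembly
  have k1 : ∀ j : I', biproduct.ι (fun _ : I' ↦ B) j ≫ biproduct.π (fun _ : I' ↦ B) j = 1 • 𝟙 B :=
    fun j ↦ by rw [biproduct.ι_π_self, one_smul]
  have k2 : ∀ j j' : I', j ≠ j' →
      biproduct.ι (fun _ : I' ↦ B) j ≫ biproduct.π (fun _ : I' ↦ B) j' = 0 :=
    fun j j' h ↦ biproduct.ι_π_ne _ h
  have k3 : ∑ j : I', biproduct.π (fun _ : I' ↦ B) j ≫ biproduct.ι (fun _ : I' ↦ B) j =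
      1 • 𝟙 (⨁ fun _ : I' ↦ B) := by rw [biproduct.total, one_smul]
  obtain ⟨u, hu⟩ := exists_isIsogeny_of_quasiDecompositions_equiv
    (X := X) (S := fun i : I' ↦ S i.1) (fun i : I' ↦ ι i.1) (fun i : I' ↦ π i.1)
    (T := fun _ : I' ↦ B) (fun j ↦ biproduct.ι (fun _ : I' ↦ B) j)
    (fun j ↦ biproduct.π (fun _ : I' ↦ B) j) hN h1' h2' h3' Nat.one_pos k1 k2 k3
    (Equiv.refl I') (fun i ↦ f i) (fun i ↦ hf i)
  -- reindex along `Fin n ≃ I'`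
  let e := Fintype.equivFin I'
  refine ⟨B, Fintype.card I', hB, IsIsogenous.trans ⟨u, hu⟩ ?_⟩
  exact ⟨(biproduct.reindex e.symm (fun _ : I' ↦ B)).inv,
    isIsogeny_hom_of_iso (biproduct.reindex e.symm (fun _ : I' ↦ B)).symm⟩

end AbelianVariety

end Literature.AlgebraicGeometry.Motives

end
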